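import Summits.QuantumFields.YangMills.Theorems.BalabanUVNodesN15KingModelFreePropagatorComparison

/-!
# BalabanUVNodes ∕ N15 — THE KING-MODEL RUNG (PART Ϻ-f): THE POSITION-SPACE BLOCK-AVERAGE FORM OF KING's CONTINUUM TWO-POINT FUNCTION IN EVERY DIMENSION —
# `S₂^{ℝ}(z) = ∫₀^∞ e^{−tm²} ∫_{[0,1]^{d+1}}∫_{[0,1]^{d+1}} k_t(z + a − b) db da dt`, `k_t(w) = (4πt)^{−(d+1)∕2}e^{−|w|²∕4t}` (the tent IS the autocorrelation of the unit block)
# (Track A, DAG node N15 = NE2; FAN-OUT v1.1 §N15 s3 «KING-MODEL RUNG»; uses parts Ϻ-a∕b∕c; count-neutral)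

HONEST FRAMING.  Count-neutral (cell `pub-ymgap`, seat `pub-ymgap-dag-n15-e` g35; `--supports stmt-QuantumFields-27366 --as helper` = K3⁸).  King's `A = 0`, `g = 0` model
([King1986] C. King, Commun. Math. Phys. **102** (1986) 649–677).  Theorem 2.1 (2.22)'s continuum covariance is that of BLOCK AVERAGES `∫_{B(z)}φ` of the free field;
part Ϝ-j gave its thermodynamic limit in momentum space, part Ϸ-q checked the `d+1 = 1` case against the position-space OU block average, and part Ϻ-b rewrote it as
`S₂^{ℝ}(z) = ∫₀^∞e^{−tm²}Π_μ(Λ ∗ g_t)(z_μ)dt` with the tent `Λ = (1−|u|)₊`.  THIS FILE proves the elementary identity behind «the tent is the block form factor» — for a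
bounded continuous `φ`, `∫_ℝ Λ(u)φ(x − u)du = ∫₀¹∫₀¹ φ(x + a − b)db da` (one substitution, one Fubini, and `|[0,1] ∩ (−u,1−u]| = (1−|u|)₊`) — and assembles, with Mathlib's
`Measure.restrict_pi_pi`∕`integral_fintype_prod_eq_prod`, the POSITION-SPACE BLOCK-AVERAGE FORM in every dimension:
`S₂^{ℝ}(z) = ∫₀^∞e^{−tm²}[∫_{a∈[0,1]^{d+1}}∫_{b∈[0,1]^{d+1}} k_t(‖z + a − b‖₂)db da]dt`, `k_t` = part Ϻ-c's `heatRadial` — the heat kernel between a point of the block at `z`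
and a point of the block at `0`, averaged over both blocks, then Laplace-transformed in proper time at `m²` (i.e. the block average of the continuum free propagator
`C_m = ∫₀^∞e^{−tm²}k_t dt`, with the proper-time integral kept outermost; exchanging it with the block averages is not carried out here).  NOT Bałaban's objects; NOT a node
discharge; nothing continuum-Yang–Mills ∕ `ℝ⁴` ∕ OS ∕ Clay.  0 `sorry`, 0 def; standard axioms.

WHAT THIS FILE PROVES (kernel).  §1 `min_sub_max_eq_one_sub_abs`, `volumeReal_Ioc_inter_eq_tent` (`|(0,1] ∩ (−u,1−u]| = Λ(u)`), ★★ **`integral_tent_mul_eq_blockAverage`** (the tent is the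
autocorrelation of the unit interval, tested against bounded continuous `φ`).  §2 ★ `tentAvg_gaussLine_eq_blockAverage`, ★★ `kingS2Inf_eq_integral_lineBlockAverages`.  §3 `prod_blockAverage_eq_cube`
(iterated unit-interval integrals ↔ the unit cube, `Measure.restrict_pi_pi`), ★★★ **`kingS2Inf_eq_integral_cubeBlockAverage_heatRadial`**.

HONEST SCOPE.  King's free model, `m² > 0`, every `d`; the proper-time integral stays outermost.  N15 untouched; counts unmoved.  Locators (use): [King1986] Thm 2.1 (2.22) p.654,
(2.3) p.651, (4.5) p.670, Thm 3.3 (3.6) p.655.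
-/

noncomputable section

open scoped BigOperators Topology
open Filter MeasureTheory Set Function

namespace Summit.QuantumFields.YangMills.BalabanUVNodes.N15KingModelRung.ProperTime

open Summit.QuantumFields.YangMills.BalabanUVNodes.N15KingModelRung.OptimalDecay
open Literature.Analysis.Fourier (tent tent_nonneg tent_le_one tent_eq tent_eq_zero continuous_tent)

variable {d : ℕ}

/-! ## §1 The tent is the autocorrelation of the unit interval -/

/-- `min(1, 1−u) − max(0, −u) = 1 − |u|` for every real `u`. [folklore] -/
theorem min_sub_max_eq_one_sub_abs (u : ℝ) : min 1 (1 - u) - max 0 (-u) = 1 - |u| := by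
  rcases le_or_gt 0 u with h | h
  · rw [min_eq_right (by linarith), max_eq_left (by linarith), abs_of_nonneg h]; ring
  · rw [min_eq_left (by linarith), max_eq_right (by linarith), abs_of_neg h]

/-- `|(0,1] ∩ (−u, 1−u]| = (1−|u|)₊ = Λ(u)`. [folklore] -/
theorem volumeReal_Ioc_inter_eq_tent (u : ℝ) : (volume (Ioc (-u) (1 - u) ∩ Ioc (0 : ℝ) 1)).toReal = tent 1 u := by
  rw [Ioc_inter_Ioc, Real.volume_Ioc, ENNReal.toReal_ofReal']
  have h := min_sub_max_eq_one_sub_abs u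
  have ht : tent 1 u = max (1 - |u|) 0 := by rw [tent, div_one]
  rw [ht, ← h, max_comm (0 : ℝ) (-u), min_comm (1 : ℝ) (1 - u)]

/-- ★★ **THE TENT IS THE AUTOCORRELATION OF THE UNIT INTERVAL**: for a bounded continuous `φ` and every `x`,
`∫_ℝ Λ(u)·φ(x − u)du = ∫₀¹∫₀¹ φ(x + a − b)db da` (substitute `u = b − a`, exchange, `|{a ∈ (0,1] : −a < u ≤ 1−a}| = Λ(u)`). [folklore] -/
theorem integral_tent_mul_eq_blockAverage {φ : ℝ → ℝ} (hφ : Continuous φ) {C : ℝ} (hC : ∀ y, |φ y| ≤ C) (x : ℝ) :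
    ∫ u : ℝ, tent 1 u * φ (x - u) = ∫ a in (0 : ℝ)..1, ∫ b in (0 : ℝ)..1, φ (x + a - b) := by
  have hC0 : 0 ≤ C := (abs_nonneg _).trans (hC 0)
  -- the integrand after the substitution `u = b − a`
  set G : ℝ → ℝ → ℝ := fun a u => (Ioc (-a) (1 - a)).indicator (fun u => φ (x - u)) u with hG
  -- Step 1: the inner integral as an indicator integral over `ℝ`
  have hinner : ∀ a : ℝ, ∫ b in (0 : ℝ)..1, φ (x + a - b) = ∫ u : ℝ, G a u := by
    intro a
    have h1 : ∫ b in (0 : ℝ)..1, φ (x + a - b) = ∫ b in (0 : ℝ)..1, (fun u => φ (x - u)) (b - a) := by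
      refine intervalIntegral.integral_congr fun b _ => ?_
      simp only
      ring_nf
    rw [h1, intervalIntegral.integral_comp_sub_right (fun u => φ (x - u)) a, zero_sub, intervalIntegral.integral_of_le (by linarith),
      ← integral_indicator measurableSet_Ioc]
  rw [intervalIntegral.integral_of_le zero_le_one]
  have hstep1 : ∫ a in Ioc (0 : ℝ) 1, ∫ b in (0 : ℝ)..1, φ (x + a - b) = ∫ a in Ioc (0 : ℝ) 1, ∫ u : ℝ, G a u :=
    setIntegral_congr_fun measurableSet_Ioc fun a _ => hinner a
  rw [hstep1]
  -- Step 2: Fubini on `(0,1] × ℝ`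
  have hT : MeasurableSet ({p : ℝ × ℝ | -p.1 < p.2} ∩ {p : ℝ × ℝ | p.2 ≤ 1 - p.1}) :=
    (measurableSet_lt (f := fun p : ℝ × ℝ => -p.1) (g := fun p : ℝ × ℝ => p.2) (by fun_prop) (by fun_prop)).inter
      (measurableSet_le (f := fun p : ℝ × ℝ => p.2) (g := fun p : ℝ × ℝ => 1 - p.1) (by fun_prop) (by fun_prop))
  have hGT : uncurry G = ({p : ℝ × ℝ | -p.1 < p.2} ∩ {p : ℝ × ℝ | p.2 ≤ 1 - p.1}).indicator fun p => φ (x - p.2) := by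
    funext p
    simp only [uncurry, hG, indicator, mem_Ioc, mem_inter_iff, mem_setOf_eq]
  have hmeas : AEStronglyMeasurable (uncurry G) ((volume.restrict (Ioc (0 : ℝ) 1)).prod volume) := by
    rw [hGT]
    exact (Continuous.aestronglyMeasurable (by fun_prop)).indicator hT
  have hmajI : Integrable (fun u : ℝ => (Icc (-1 : ℝ) 1).indicator (fun _ => C) u) := by
    refine (integrable_indicator_iff measurableSet_Icc).mpr (integrableOn_const ?_)
    rw [Real.volume_Icc]; exact ENNReal.ofReal_ne_top
  have h1 : Integrable (fun _ : ℝ => (1 : ℝ)) (volume.restrict (Ioc (0 : ℝ) 1)) :=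
    integrableOn_const (by rw [Real.volume_Ioc]; exact ENNReal.ofReal_ne_top)
  have hmaj := h1.mul_prod hmajI
  have hae : ∀ᵐ p : ℝ × ℝ ∂((volume.restrict (Ioc (0 : ℝ) 1)).prod volume), p.1 ∈ Ioc (0 : ℝ) 1 :=
    (Measure.quasiMeasurePreserving_fst (μ := volume.restrict (Ioc (0 : ℝ) 1)) (ν := (volume : Measure ℝ))).ae (ae_restrict_mem measurableSet_Ioc)
  have hint : Integrable (uncurry G) ((volume.restrict (Ioc (0 : ℝ) 1)).prod volume) := by
    refine hmaj.mono' hmeas ?_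
    filter_upwards [hae] with p hp
    simp only [uncurry, hG, one_mul, Real.norm_eq_abs]
    by_cases hu : p.2 ∈ Ioc (-p.1) (1 - p.1)
    · rw [indicator_of_mem hu]
      have hu' : p.2 ∈ Icc (-1 : ℝ) 1 := ⟨by linarith [hu.1, hp.2], by linarith [hu.2, hp.1]⟩
      rw [indicator_of_mem hu']
      exact hC _
    · rw [indicator_of_notMem hu, abs_zero]
      exact indicator_nonneg (fun _ _ => hC0) _
  rw [integral_integral_swap hint]
  -- Step 3: the inner `a`-integral is `Λ(u)·φ(x−u)`
  refine integral_congr_ae (Eventually.of_forall fun u => ?_)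
  simp only
  have hGu : (fun a : ℝ => G a u) = (Ioc (-u) (1 - u)).indicator fun _ => φ (x - u) := by
    funext a
    simp only [hG, indicator, mem_Ioc]
    have : (-a < u ∧ u ≤ 1 - a) ↔ (-u < a ∧ a ≤ 1 - u) := by constructor <;> rintro ⟨h1, h2⟩ <;> constructor <;> linarith
    simp only [this]
  rw [hGu, integral_indicator_const _ measurableSet_Ioc, Measure.real, Measure.restrict_apply measurableSet_Ioc, volumeReal_Ioc_inter_eq_tent, smul_eq_mul]

/-! ## §2 King's two-point function through one-dimensional block averages of the heat kernel -/

/-- ★ `J_t(x) = ∫Λ(u)g_t(x−u)du = ∫₀¹∫₀¹ g_t(x + a − b)db da` (`t > 0`). [folklore] -/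
theorem tentAvg_gaussLine_eq_blockAverage {t : ℝ} (ht : 0 < t) (x : ℝ) :
    ∫ u : ℝ, tent 1 u * gaussLine t (x - u) = ∫ a in (0 : ℝ)..1, ∫ b in (0 : ℝ)..1, gaussLine t (x + a - b) :=
  integral_tent_mul_eq_blockAverage (continuous_gaussLine t) (C := gaussLine t 0)
    (fun y => by rw [abs_of_nonneg (gaussLine_nonneg _ _)]; exact gaussLine_le_zero_val ht y) x

/-- ★★ `S₂^{ℝ}(z) = ∫₀^∞ e^{−tm²}·Π_μ [∫₀¹∫₀¹ g_t(z_μ + a − b)db da] dt` — each coordinate's heat kernel averaged over the two unit intervals.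
[cite: King1986, Thm 2.1 (2.22) p.654, (2.3) p.651, (4.5) p.670] -/
theorem kingS2Inf_eq_integral_lineBlockAverages {m2 : ℝ} (hm : 0 < m2) (z : Fin (d + 1) → ℤ) :
    kingS2Inf m2 z = ∫ t in Ioi (0 : ℝ), Real.exp (-(t * m2)) * ∏ μ, ∫ a in (0 : ℝ)..1, ∫ b in (0 : ℝ)..1, gaussLine t ((z μ : ℝ) + a - b) := by
  rw [kingS2Inf_eq_integral_tent_gaussLine hm z]
  refine setIntegral_congr_fun measurableSet_Ioi fun t ht => ?_
  congr 1
  exact Finset.prod_congr rfl fun μ _ => tentAvg_gaussLine_eq_blockAverage ht _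

/-! ## §3 The unit cube: the position-space block-average form -/

/-- Iterated unit-interval integrals, one pair per coordinate, ARE the double block average over the unit cube `(0,1]^{d+1}`:
`Π_μ ∫₀¹∫₀¹ F_μ(a, b)db da = ∫_{a∈(0,1]^{d+1}}∫_{b∈(0,1]^{d+1}} Π_μ F_μ(a_μ, b_μ)db da` (Mathlib `Measure.restrict_pi_pi` + `integral_fintype_prod_eq_prod`). [folklore] -/
theorem prod_blockAverage_eq_cube (F : Fin (d + 1) → ℝ → ℝ → ℝ) :
    ∏ μ, (∫ a in Ioc (0 : ℝ) 1, ∫ b in Ioc (0 : ℝ) 1, F μ a b)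
      = ∫ a in Set.pi univ (fun _ : Fin (d + 1) => Ioc (0 : ℝ) 1), ∫ b in Set.pi univ (fun _ : Fin (d + 1) => Ioc (0 : ℝ) 1), ∏ μ, F μ (a μ) (b μ) := by
  rw [volume_pi, Measure.restrict_pi_pi]
  have hinner : ∀ a : Fin (d + 1) → ℝ, ∫ b, ∏ μ, F μ (a μ) (b μ) ∂(Measure.pi fun _ : Fin (d + 1) => volume.restrict (Ioc (0 : ℝ) 1))
      = ∏ μ, ∫ b in Ioc (0 : ℝ) 1, F μ (a μ) b := fun a =>
    integral_fintype_prod_eq_prod (fun μ b => F μ (a μ) b)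
  simp_rw [hinner]
  rw [integral_fintype_prod_eq_prod (fun μ a => ∫ b in Ioc (0 : ℝ) 1, F μ a b)]

/-- ★★★ **THE POSITION-SPACE BLOCK-AVERAGE FORM OF KING's CONTINUUM TWO-POINT FUNCTION, EVERY DIMENSION**: for `m² > 0` and every `z ∈ ℤ^{d+1}`,
`S₂^{ℝ}(z) = ∫₀^∞ e^{−tm²}·[∫_{a∈(0,1]^{d+1}}∫_{b∈(0,1]^{d+1}} k_t(‖z + a − b‖₂)db da]dt`, `k_t(R) = (4πt)^{−(d+1)∕2}e^{−R²∕4t}`: the `(d+1)`-dimensional heat kernel between a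
point of the unit block at `z` and a point of the unit block at `0`, averaged over both blocks, Laplace-transformed in proper time at `m²` — the continuum free
propagator `C_m = ∫₀^∞e^{−tm²}k_t dt` averaged over the two blocks (proper time outermost), i.e. (2.22)'s covariance of block averages in position space.
[cite: King1986, Thm 2.1 (2.22) p.654, (2.3) p.651, (4.5) p.670, Thm 3.3 (3.6) p.655] -/
theorem kingS2Inf_eq_integral_cubeBlockAverage_heatRadial {m2 : ℝ} (hm : 0 < m2) (z : Fin (d + 1) → ℤ) :
    kingS2Inf m2 z = ∫ t in Ioi (0 : ℝ), Real.exp (-(t * m2)) *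
      ∫ a in Set.pi univ (fun _ : Fin (d + 1) => Ioc (0 : ℝ) 1), ∫ b in Set.pi univ (fun _ : Fin (d + 1) => Ioc (0 : ℝ) 1),
        heatRadial d t (Real.sqrt (∑ μ, ((z μ : ℝ) + a μ - b μ) ^ 2)) := by
  rw [kingS2Inf_eq_integral_lineBlockAverages hm z]
  refine setIntegral_congr_fun measurableSet_Ioi fun t _ => ?_
  congr 1
  simp_rw [intervalIntegral.integral_of_le zero_le_one, ← prod_gaussLine_eq_heatRadial]
  exact prod_blockAverage_eq_cube (fun μ a b => gaussLine t ((z μ : ℝ) + a - b))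

end Summit.QuantumFields.YangMills.BalabanUVNodes.N15KingModelRung.ProperTime
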